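import Mathlib
import Summits.Ventures.FusionMHD.Models.CerfonFreidbergIterLikeQHalfShearDefs
import HarnessLib

/-!
# Ventures/FusionMHD — Models/CerfonFreidbergIterLikeQHalfShearPanels9.lean: KERNEL CHECK of the shear-register certificates of panels 16, 17 (of 32)
# at `ψ_N = 1/2` of THE Cerfon–Freidberg ITER-like instance

HONEST FRAMING (LADDER-GRIDFUSION three columns; CF rung; successor step of «q′(ψ_N = 1/2) on the CF rung», F2-SCOPING v1.6 §10(c)).  One `decide +kernel`
(≈ 80 s): for each listed panel the obligation `CFIterLike.QHalfShear.ShearCert.ok` (`Models/CerfonFreidbergIterLikeQHalfShearDefs.lean`) — the Taylor-model run of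
`progQ = CFIterLike.QHalf.progA ++ blockQ` over ★ #117's parameter box is ACCEPTED and the kernel's panel-integral enclosure of the shear kernel `K·p` along the
approximant lies inside the claimed integers (read off a compiled `#eval` of the same functions, slack one unit of `2⁻⁶⁰`; float truth inside every panel).
MODELLED: analytic Cerfon–Freidberg family; nothing about a device or stability.  No `native_decide`.  Typer/prover: gridfusion-model-5 (g8), 2026-08-27.
Citations: Freidberg 2014 §6.3.5 (6.35) [Freidberg2014]; Mahboubi–Melquiond–Sibut-Pinote 2016 §3.2 Lemma 3 [MahboubiMelquiondSibutpinote2016].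
-/

namespace Summit.Ventures.FusionMHD.Models.CFIterLike.QHalfShear

/-- Shear-register certificate data of panels 16, 17. [instance data] -/
def shearCert9 : List ShearCert := [
  { j := 16, cand := [1053742565972949073920, 11260024785821587472384, 56759821329612138348544, -22462769038148235165696, -2609139275242126614462464, -18945682092539328600211456, -33024470036442960957014016, 532741899575887130206928896, 5180682151178635040438353920, 15603842480792478555207368704, -89271660446700780497655562240, -1177921097444652438661273485312, -13151460019403251227070711201792],
    deg := 10, elog2 := 45, plo := 1342007018947498859, phi := 1342007265040911544 },
  { j := 17, cand := [1457299232202230857728, 14331727753217979711488, 33590636983176814133248, -526672736130316187467776, -5112072722789491913261056, -4825608770458063627878400, 225781481070982717503438848, 1560817292238879400136802304, -1974256227761468961745534976, -86417906632058655284651884544, -391557939105819423664014098432, 1945190411371678871309068009472, 27216304067560397221600339951616],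
    deg := 10, elog2 := 46, plo := 4210308324000857178, phi := 4210308990104579231 }]

/-- **KERNEL CHECK** of the shear register on panels 16, 17. -/
theorem shearCert9_ok : CFIterLike.QHalfShear.shearCert9.all ShearCert.ok = true := by
  decide +kernel

end Summit.Ventures.FusionMHD.Models.CFIterLike.QHalfShear
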